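/-
Copyright (c) 2026 the pub-hodgecm-mathlib formalisation cell (harness21).  Prover seat hodgecm-mathlib-LH7-p09 (g2), CLOSE-OUT ROSTER strike line L3∕L5 (Track A
«(D-RAM) FOUR-FRAME» squad F0∕P3c∕LH4 ∕ F0∕P3c∕LH7); β₂-BOARD v2 row (OFF) (lead LH7-p09 (g2); assembler LH4-p12 (g8) ED. 5 `…OffRowOfPiecesResidual`, socket `hL`, MIX band);
helper lane on h413 = stmt-HodgeConjecture-24833 (count-neutral).  2026-09-05.
-/
import Summits.HodgeConjecture.HodgeConjecture.Theorems.F0P3cDyRamDepthScalar                 -- ★ p861454 (LH4-p16): `ray_eq_valueSetMod_smul_xPlus`, `ray_subset_normFormSet`; brings ★ DEFS, ★ `…ShellLineModel`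
import Summits.HodgeConjecture.HodgeConjecture.Theorems.F0P3cDyRamTerminalCellOffShellCardTwo  -- ★ p862572 (this seat): `map_sub_div_eq`, `map_sub_mul_eq` (the `Fix ρ`-coordinates)
import HarnessLib

/-!
# Crux `H413`, line LH4 «(D-RAM) FOUR-FRAME» — the (β₂) road (R-36), β₂-BOARD v2 row (OFF), socket `hL`, the MIX band: «THE NORM-FORM LETTER IS A RAY BY THE TRACE IDEAL» —
# ★ p861454's `hsmall` road WITHOUT ray domination: over `Λ = x₀·𝒪_cc` the value at `(ζ, a)` is `ϖ^m`-close to the `a`-RAY value at the `Fix ρ`-coordinate `p` of `Yζ + jE a`,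
# as soon as `|c|·|cc|·max(|ϖ|^{d−1}, |Θα − α|, |cc|) ≤ |ϖE|^m` — the cross term is a TRACE `Tr_{E∕F}(p·σq)` of an element of `𝔭_E^j`, small by the different

Cell `hodgecm-mathlib` (D-0151), FLOOR 0, crux item H413 = `stmt-HodgeConjecture-24833`, route of record `HCCMUnconditional`; squads F0∕P3c∕LH4 ∕ LH7; lane
`--supports stmt-HodgeConjecture-24833 --as helper` (count-neutral; pays NO tier-0 row).  THEOREMS ONLY (no `def`, no instance, no notation, no `sorry`, default heartbeats);
★-only imports; states NO law; (β₂) stays a HYPOTHESIS.  DATUM-LIGHT: ★ DEFS' `M`-letters (`ρ` an isometric involution, `Θ` isometric with `Θ ∘ jE = jE ∘ σ`, `Fix ρ = jE(E)`, `jE`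
isometric, `|α| ≤ 1`, `ρα ≠ α`), an order parameter `cc` (`|cc| ≤ 1`), `Y ∈ 𝒪_cc`, ANY coefficient `c`, and a trace bound `|x + σx| ≤ |ϖ|^{d₁}·|x|` on `E` (★ Lit
`WildQuadraticDatum.trace_bound_pow_of_isRamifiedQuadraticDatum`: `d₁ = d − 1`).  NO residue field, NO `|2|`.

WHY (BETA2-OFF-RESIDUAL v1 §2 «MIX band», `F0/P3c/LH7/LH7-p09/g2/`).  By ★ p861372 HEAD B the census letter of a glued vertex over `Λ = x₀·𝒪_cc` is the norm-form set
`{Tr_ρ(c·N_Θ(Yζ + jE a)) : ζ ∈ 𝒪_cc, |a| ≤ 1}` (`c = μ∕(cc(α − ρα)·ΘY)`), and ★ p861454 `normFormSet_eq_ray_of_small` makes it the thickened `a`-RAY `valueSetMod σ ϖ m ((e₀t₊⁻¹) • X₊)`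
(`jE e₀ = Tr_ρ c`) PROVIDED the `ζ`-terms are `ϖ^m`-small at FIXED `a` (`hsmall`) — which ★ p861653 gets from RAY DOMINATION `μ = ϖE^{m′}μ_t`, `μ_t ∈ 𝒪_cc`, `m′ ≥ m`.  On the
lower line's MIX band `b + ℓ₀ < m*` ray domination FAILS (the `Fix ρ`-part of `Yζ` has size `|ϖE|^b` and moves the `a`-coordinate), yet the letter is STILL the ray: write
`η := Yζ + jE a = jE p + jE q·α` in the `Fix ρ`-basis (`|p| ≤ 1`, `|q| ≤ |cc|` since `η ∈ 𝒪_cc`); then with `x := p·σq`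
  `N_Θ(η) − N(p) = jE(x + σx)·α + jE x·(Θα − α) + jE(N q)·αΘα`,
so `Tr_ρ(c·N_Θ η) − Tr_ρ(c)·N(p)` has size `≤ |c|·max(|x + σx|, |x|·|Θα − α|, |q|²) ≤ |c|·|cc|·max(|ϖ|^{d−1}, |Θα − α|, |cc|)` — the cross term is a TRACE of an element of
`cc·𝒪_E = 𝔭_E^j`, and `Tr 𝔭_E^j ⊆ 𝔭_F^{⌊(j+d)∕2⌋}` (Serre III §3).  Hence the value at `(ζ, a)` is `ϖ^m`-close to the RAY value at `p` (not at `a`): the letter equals the ray.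
* §1 `norm_sub_norm_eq_of_coords` (the identity), `exists_rayPoint_of_trace` — ∀ `ζ ∈ 𝒪_cc`, `|a| ≤ 1` ∃ `p`, `|p| ≤ 1`, `|(ϖE^m)⁻¹·(value(ζ, a) − value(0, p))| ≤ 1` under
  `h1 : |c|·|cc|·|ϖE|^{d₁} ≤ |ϖE|^m`, `h2 : |c|·|cc|·|Θα − α| ≤ |ϖE|^m`, `h3 : |c|·|cc|² ≤ |ϖE|^m`.
* §2 HEAD `normFormSet_eq_ray_of_trace` — ★ p861454∕p861653's conclusion VERBATIM (`{z ∣ ∃ ζ a, …} = valueSetMod σ ϖ m ((e₀·t₊⁻¹) • xPlus σ ϖ d)`) from `h1 h2 h3` instead of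
  `hμ hμt hmm`; §3 `line_letters_of_sizes` — `h1 h2 h3` at `c := μ∕(cc(α − ρα)·ΘY)` from the μ-currency sizes `|μ|·|ϖE|^{d₁} ≤ |α − ρα|·|ϖE|^{b+m}`, `|μ|·|Θα − α| ≤ …`,
  `|μ|·|cc| ≤ …` (`|Y| = |ϖE|^b`), and HEAD `normFormSet_eq_ray_of_line_sizes` (the two combined at `Y := dualGen ρ Θ α cc h_M x₀`).  On the lower line (`|μ| = |ϖE|^{m₀}`,
  `|α − ρα| = 1`, `m := m*`): `m₀ + d − 1 ≥ b + m*`, `m₀ + v(Θα − α) ≥ b + m*`, `m₀ + j ≥ b + m*` — all three from the fence `m₀ ≥ m_c` at `d ≤ 4` (BETA2-OFF-RESIDUAL v1 §2).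
HONEST LABEL.  Count-neutral valuation ∕ order algebra; nothing printed is asserted; no census law is stated; the balance `hL` stays OPEN; `HC_CM` is proved only modulo the 7 printed
citations (2 remaining named inputs: hLiu418 = `stmt-HodgeConjecture-24832`, h413 = `stmt-HodgeConjecture-24833`) until rung 0 closes.
## References
* [Serre1979] J.-P. Serre, *Local Fields*, GTM 67 (1979): Ch. III §3 Prop. 7 (`Tr 𝔭_E^j = 𝔭_F^{⌊(j+d)∕2⌋}`), Ch. III §6 Prop. 12 (orders of conductor `c`), Ch. V §3 Cor. 3.
* [Jacobowitz1962] R. Jacobowitz, *Hermitian forms over local fields*, Amer. J. Math. 84 (1962): §4 (duals, gluing).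
* [Rogawski1990] J. D. Rogawski, *Automorphic Representations of Unitary Groups in Three Variables*, Ann. of Math. Stud. 123 (1990): §4.9 Prop. 4.9.1 (b) p. 55.
* [Kottwitz1986BaseChangeUnits] R. E. Kottwitz, *Base change for unit elements of Hecke algebras*, Compositio Math. 60 (1986): §1 pp. 240–241.
-/

set_option autoImplicit false

noncomputable section

namespace Summit.HodgeConjecture.HodgeConjecture.Cruxes.H413.F0P3cDyRamNormFormRayOfTrace

open scoped Valued WithZero Matrix MatrixGroups
open WithZero
open Literature.NumberTheory.Automorphic Literature.NumberTheory.Automorphic.HermitianLattice Literature.NumberTheory.Automorphic.UnitaryLatticeTree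
open Literature.NumberTheory.Rogawski1990
open Summit.HodgeConjecture.HodgeConjecture.Cruxes.H413.F0P3cDyRamFourFramePieces
open Summit.HodgeConjecture.HodgeConjecture.Cruxes.H413.F0P3cDyRamToricCensusDefs
open Summit.HodgeConjecture.HodgeConjecture.Cruxes.H413.F0P3cDyRamShellLineModel (isOrd_mul)
open Summit.HodgeConjecture.HodgeConjecture.Cruxes.H413.F0P3cDyRamDepthScalar (ray_eq_valueSetMod_smul_xPlus ray_subset_normFormSet)
open Summit.HodgeConjecture.HodgeConjecture.Cruxes.H413.F0P3cDyRamTerminalCellOffShellCardTwo (map_sub_div_eq map_sub_mul_eq)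

variable {E M : Type} [Field E] [Valued E ℤᵐ⁰] [Field M] [Valued M ℤᵐ⁰] {ρ Θ : M →+* M} {α : M}

/-! ## §1 The value at `(ζ, a)` is `ϖ^m`-close to the ray value at the `Fix ρ`-coordinate of `Yζ + jE a` -/

omit [Valued E ℤᵐ⁰] [Valued M ℤᵐ⁰] in
/-- **THE NORM DIFFERENCE IN COORDINATES**: `Θ ∘ jE = jE ∘ σ`, `σ` an involution; for `η = jE p + jE q·α`,
`η·Θη − jE p·Θ(jE p) = jE(pσq + σ(pσq))·α + jE(pσq)·(Θα − α) + jE(q·σq)·(α·Θα)`. [cite: Serre1979, Ch. III §6 Prop. 12] -/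
theorem norm_sub_norm_eq_of_coords (σ : E →+* E) (hσσ : ∀ x, σ (σ x) = x) (jE : E →+* M) (hΘj : ∀ x, Θ (jE x) = jE (σ x)) (p q : E) :
    (jE p + jE q * α) * Θ (jE p + jE q * α) - jE p * Θ (jE p) =
      jE (p * σ q + σ (p * σ q)) * α + jE (p * σ q) * (Θ α - α) + jE (q * σ q) * (α * Θ α) := by
  simp only [map_add, map_mul, hΘj, hσσ]
  ring

/-- **EVERY VALUE IS `ϖ^m`-CLOSE TO A RAY VALUE** (the `hsmall` road of ★ p861454 WITHOUT ray domination).  `ρ` an isometric involution with `Fix ρ = jE(E)`, `ρα ≠ α`, `|α| ≤ 1`,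
`Θ` isometric with `Θ ∘ jE = jE ∘ σ`, `σ` an isometric involution, `jE` isometric; a trace bound `|x + σx| ≤ |ϖ|^{d₁}·|x|` on `E`; an order parameter `cc` (`|cc| ≤ 1`),
`Y ∈ 𝒪_cc`, a coefficient `c`, a modulus `m`, and the three smallness letters `h1 h2 h3`.  THEN for all `ζ ∈ 𝒪_cc`, `|a| ≤ 1` there is `p`, `|p| ≤ 1`, with
`|(ϖE^m)⁻¹·((c·N_Θ(Yζ + jE a) + ρ(…)) − (c·N_Θ(Y·0 + jE p) + ρ(…)))| ≤ 1`. [cite: Serre1979, Ch. III §3 Prop. 7; §6 Prop. 12] [cite: Jacobowitz1962, §4] -/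
theorem exists_rayPoint_of_trace (hρρ : ∀ x, ρ (ρ x) = x) (hvρ : ∀ x, Valued.v (ρ x) = Valued.v x) (hα : ρ α ≠ α) (hα1 : Valued.v α ≤ 1)
    (hvΘ : ∀ x, Valued.v (Θ x) = Valued.v x)
    (σ : E →+* E) (hσσ : ∀ x, σ (σ x) = x) (hvσ : ∀ a, Valued.v (σ a) = Valued.v a)
    (jE : E →+* M) (hjiso : ∀ x, Valued.v (jE x) = Valued.v x) (hΘj : ∀ x, Θ (jE x) = jE (σ x)) (hjfix : ∀ z, ρ z = z ↔ ∃ c, jE c = z)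
    {ϖ : E} (hjϖ0 : jE ϖ ≠ 0) {d₁ : ℕ} (htr : ∀ x : E, Valued.v (x + σ x) ≤ Valued.v ϖ ^ d₁ * Valued.v x)
    {cc : M} (hc1 : Valued.v cc ≤ 1) {Y : M} (hYO : IsOrd ρ α cc Y) (c : M) (m : ℕ)
    (h1 : Valued.v c * Valued.v cc * Valued.v (jE ϖ) ^ d₁ ≤ Valued.v (jE ϖ) ^ m)
    (h2 : Valued.v c * Valued.v cc * Valued.v (Θ α - α) ≤ Valued.v (jE ϖ) ^ m)
    (h3 : Valued.v c * Valued.v cc * Valued.v cc ≤ Valued.v (jE ϖ) ^ m) :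
    ∀ (ζ : M) (a : E), IsOrd ρ α cc ζ → Valued.v a ≤ 1 → ∃ p : E, Valued.v p ≤ 1 ∧
      Valued.v ((jE ϖ ^ m)⁻¹ * ((c * ((Y * ζ + jE a) * Θ (Y * ζ + jE a)) + ρ (c * ((Y * ζ + jE a) * Θ (Y * ζ + jE a)))) -
        (c * ((Y * 0 + jE p) * Θ (Y * 0 + jE p)) + ρ (c * ((Y * 0 + jE p) * Θ (Y * 0 + jE p)))))) ≤ 1 := by
  intro ζ a hζ ha
  have hα0 : α - ρ α ≠ 0 := sub_ne_zero.2 (Ne.symm hα)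
  have hvα0 : Valued.v (α - ρ α) ≠ 0 := (Valuation.ne_zero_iff _).2 hα0
  have hvαpos : 0 < Valued.v (α - ρ α) := zero_lt_iff.2 hvα0
  have hpm0 : jE ϖ ^ m ≠ 0 := pow_ne_zero _ hjϖ0
  have hvpmpos : 0 < Valued.v (jE ϖ ^ m) := zero_lt_iff.2 ((Valuation.ne_zero_iff _).2 hpm0)
  -- `η = Yζ + jE a ∈ 𝒪_cc` and its `Fix ρ`-coordinates
  set η : M := Y * ζ + jE a with hηdef
  have hYζ : IsOrd ρ α cc (Y * ζ) := isOrd_mul hvρ hYO hζ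
  have hρa : ρ (jE a) = jE a := (hjfix _).2 ⟨a, rfl⟩
  have hηanti : η - ρ η = Y * ζ - ρ (Y * ζ) := by rw [hηdef, map_add, hρa]; ring
  have hη1 : Valued.v η ≤ 1 := by
    rw [hηdef]
    refine (Valuation.map_add _ _ _).trans (max_le hYζ.1 ?_)
    rw [hjiso]; exact ha
  set q' : M := (η - ρ η) / (α - ρ α) with hq'def
  set p' : M := η - q' * α with hp'def
  have hρq' : ρ q' = q' := by rw [hq'def]; exact map_sub_div_eq hρρ η
  have hρp' : ρ p' = p' := by rw [hp'def, hq'def]; exact map_sub_mul_eq hρρ hα η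
  obtain ⟨q, hq⟩ := (hjfix q').1 hρq'
  obtain ⟨p, hp⟩ := (hjfix p').1 hρp'
  have hvq : Valued.v q ≤ Valued.v cc := by
    rw [← hjiso, hq, hq'def, Valuation.map_div, div_le_iff₀ hvαpos, hηanti, ← Valuation.map_mul]
    exact hYζ.2
  have hvp : Valued.v p ≤ 1 := by
    rw [← hjiso, hp, hp'def]
    refine (Valuation.map_sub _ _ _).trans (max_le hη1 ?_)
    rw [Valuation.map_mul, ← hq, hjiso]
    exact mul_le_one' (hvq.trans hc1) hα1
  have hηpq : η = jE p + jE q * α := by rw [hp, hq, hp'def]; ring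
  refine ⟨p, hvp, ?_⟩
  -- the difference of the two values is `c·D + ρ(c·D)` with `D` in coordinates
  set x : E := p * σ q with hxdef
  have hD : η * Θ η - jE p * Θ (jE p) = jE (x + σ x) * α + jE x * (Θ α - α) + jE (q * σ q) * (α * Θ α) := by
    rw [hηpq, hxdef]; exact norm_sub_norm_eq_of_coords σ hσσ jE hΘj p q
  have e : (c * ((Y * ζ + jE a) * Θ (Y * ζ + jE a)) + ρ (c * ((Y * ζ + jE a) * Θ (Y * ζ + jE a)))) -
      (c * ((Y * 0 + jE p) * Θ (Y * 0 + jE p)) + ρ (c * ((Y * 0 + jE p) * Θ (Y * 0 + jE p)))) =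
      c * (η * Θ η - jE p * Θ (jE p)) + ρ (c * (η * Θ η - jE p * Θ (jE p))) := by
    rw [mul_zero, zero_add, ← hηdef, map_mul ρ c (η * Θ η - jE p * Θ (jE p)), map_sub ρ (η * Θ η), mul_sub, map_mul ρ c, map_mul ρ c]
    ring
  -- sizes of the three terms
  have hvx : Valued.v x ≤ Valued.v cc := by
    rw [hxdef, Valuation.map_mul, hvσ]
    calc Valued.v p * Valued.v q ≤ 1 * Valued.v cc := mul_le_mul' hvp hvq
      _ = Valued.v cc := one_mul _
  have hT1 : Valued.v (c * (jE (x + σ x) * α)) ≤ Valued.v (jE ϖ) ^ m := by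
    rw [Valuation.map_mul, Valuation.map_mul, hjiso]
    calc Valued.v c * (Valued.v (x + σ x) * Valued.v α) ≤ Valued.v c * (Valued.v ϖ ^ d₁ * Valued.v x * 1) :=
          mul_le_mul_right (mul_le_mul' (htr x) hα1) _
      _ ≤ Valued.v c * (Valued.v ϖ ^ d₁ * Valued.v cc * 1) := mul_le_mul_right (mul_le_mul_left (mul_le_mul_right hvx _) _) _
      _ = Valued.v c * Valued.v cc * Valued.v (jE ϖ) ^ d₁ := by rw [hjiso, mul_one]; ac_rfl
      _ ≤ Valued.v (jE ϖ) ^ m := h1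
  have hT2 : Valued.v (c * (jE x * (Θ α - α))) ≤ Valued.v (jE ϖ) ^ m := by
    rw [Valuation.map_mul, Valuation.map_mul, hjiso]
    calc Valued.v c * (Valued.v x * Valued.v (Θ α - α)) ≤ Valued.v c * (Valued.v cc * Valued.v (Θ α - α)) :=
          mul_le_mul_right (mul_le_mul_left hvx _) _
      _ = Valued.v c * Valued.v cc * Valued.v (Θ α - α) := by ac_rfl
      _ ≤ Valued.v (jE ϖ) ^ m := h2
  have hT3 : Valued.v (c * (jE (q * σ q) * (α * Θ α))) ≤ Valued.v (jE ϖ) ^ m := by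
    rw [Valuation.map_mul, Valuation.map_mul, hjiso, Valuation.map_mul, hvσ, Valuation.map_mul, hvΘ]
    calc Valued.v c * (Valued.v q * Valued.v q * (Valued.v α * Valued.v α)) ≤ Valued.v c * (Valued.v cc * Valued.v cc * (1 * 1)) :=
          mul_le_mul_right (mul_le_mul' (mul_le_mul' hvq hvq) (mul_le_mul' hα1 hα1)) _
      _ = Valued.v c * Valued.v cc * Valued.v cc := by rw [mul_one, mul_one, mul_assoc]
      _ ≤ Valued.v (jE ϖ) ^ m := h3
  have hcD : Valued.v (c * (η * Θ η - jE p * Θ (jE p))) ≤ Valued.v (jE ϖ) ^ m := by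
    rw [hD, mul_add, mul_add]
    exact (Valuation.map_add _ _ _).trans (max_le ((Valuation.map_add _ _ _).trans (max_le hT1 hT2)) hT3)
  rw [e, Valuation.map_mul, map_inv₀, Valuation.map_pow, ← div_eq_inv_mul, div_le_one₀ (by rw [← Valuation.map_pow]; exact hvpmpos)]
  exact (Valuation.map_add _ _ _).trans (max_le hcD (by rw [hvρ]; exact hcD))

/-! ## §2 HEAD — the norm-form letter is the ray -/

/-- **HEAD — «THE NORM-FORM LETTER IS A RAY BY THE TRACE IDEAL».**  Letters of `exists_rayPoint_of_trace` + the sheet-datum letters of ★ p861454 `ray_eq_valueSetMod_smul_xPlus`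
(`|ϖ| = exp(−1)`, `|ϖ − σϖ| = |ϖ|^d`, `|jE c| ≤ 1 ↔ |c| ≤ 1`) and the ray scalar `jE e₀ = c + ρc`.  THEN the letter `{z ∣ ∃ ζ a, IsOrd ζ ∧ |a| ≤ 1 ∧ |(ϖE^m)⁻¹(jE z − (c·N_Θ(Yζ + jE a) + ρ(…)))| ≤ 1}`
EQUALS `valueSetMod σ ϖ m ((e₀·t₊⁻¹) • xPlus σ ϖ d)` — ★ p861653's conclusion, from `h1 h2 h3` in place of ray domination.
[cite: Rogawski1990, §4.9 Prop. 4.9.1 (b) p. 55] [cite: Serre1979, Ch. III §3 Prop. 7] [cite: Jacobowitz1962, §4] -/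
theorem normFormSet_eq_ray_of_trace (hρρ : ∀ x, ρ (ρ x) = x) (hvρ : ∀ x, Valued.v (ρ x) = Valued.v x) (hα : ρ α ≠ α) (hα1 : Valued.v α ≤ 1)
    (hvΘ : ∀ x, Valued.v (Θ x) = Valued.v x)
    (σ : E →+* E) (hσσ : ∀ x, σ (σ x) = x) (hvσ : ∀ a, Valued.v (σ a) = Valued.v a)
    {ϖ : E} (hϖ : Valued.v ϖ = exp (-1 : ℤ)) {d : ℕ} (hd : Valued.v (ϖ - σ ϖ) = Valued.v ϖ ^ d)
    (jE : E →+* M) (hjv : ∀ c, Valued.v (jE c) ≤ 1 ↔ Valued.v c ≤ 1) (hjiso : ∀ x, Valued.v (jE x) = Valued.v x)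
    (hΘj : ∀ x, Θ (jE x) = jE (σ x)) (hjfix : ∀ z, ρ z = z ↔ ∃ c, jE c = z)
    {d₁ : ℕ} (htr : ∀ x : E, Valued.v (x + σ x) ≤ Valued.v ϖ ^ d₁ * Valued.v x)
    {cc : M} (hc1 : Valued.v cc ≤ 1) {Y : M} (hYO : IsOrd ρ α cc Y) (c : M) {e₀ : E} (he₀ : jE e₀ = c + ρ c) (m : ℕ)
    (h1 : Valued.v c * Valued.v cc * Valued.v (jE ϖ) ^ d₁ ≤ Valued.v (jE ϖ) ^ m)
    (h2 : Valued.v c * Valued.v cc * Valued.v (Θ α - α) ≤ Valued.v (jE ϖ) ^ m)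
    (h3 : Valued.v c * Valued.v cc * Valued.v cc ≤ Valued.v (jE ϖ) ^ m) :
    {z : E | ∃ (ζ : M) (a : E), IsOrd ρ α cc ζ ∧ Valued.v a ≤ 1 ∧
        Valued.v ((jE ϖ ^ m)⁻¹ * (jE z - (c * ((Y * ζ + jE a) * Θ (Y * ζ + jE a)) + ρ (c * ((Y * ζ + jE a) * Θ (Y * ζ + jE a)))))) ≤ 1} =
      valueSetMod σ ϖ m ((e₀ * ((ϖ - σ ϖ) * ((ϖ * σ ϖ) ^ ((d - d % 2) / 2))⁻¹)⁻¹) • xPlus σ ϖ d) := by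
  have hvϖ0 : Valued.v ϖ ≠ 0 := by rw [hϖ]; exact exp_ne_zero
  have hϖ0 : ϖ ≠ 0 := fun h0 => hvϖ0 (by rw [h0, map_zero])
  have hjϖ0 : jE ϖ ≠ 0 := (map_ne_zero jE).2 hϖ0
  rw [← ray_eq_valueSetMod_smul_xPlus σ hvσ hϖ hd jE hjv hΘj hjfix c Y he₀ m]
  refine Set.Subset.antisymm ?_ (ray_subset_normFormSet (ρ := ρ) (α := α) jE ϖ m cc c Y)
  rintro z ⟨ζ, a, hζ, ha, hz⟩
  obtain ⟨p, hp, hsmall⟩ := exists_rayPoint_of_trace hρρ hvρ hα hα1 hvΘ σ hσσ hvσ jE hjiso hΘj hjfix hjϖ0 htr hc1 hYO c m h1 h2 h3 ζ a hζ ha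
  refine ⟨p, hp, ?_⟩
  have e : (jE ϖ ^ m)⁻¹ * (jE z - (c * ((Y * 0 + jE p) * Θ (Y * 0 + jE p)) + ρ (c * ((Y * 0 + jE p) * Θ (Y * 0 + jE p))))) =
      (jE ϖ ^ m)⁻¹ * (jE z - (c * ((Y * ζ + jE a) * Θ (Y * ζ + jE a)) + ρ (c * ((Y * ζ + jE a) * Θ (Y * ζ + jE a))))) +
        (jE ϖ ^ m)⁻¹ * ((c * ((Y * ζ + jE a) * Θ (Y * ζ + jE a)) + ρ (c * ((Y * ζ + jE a) * Θ (Y * ζ + jE a)))) -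
          (c * ((Y * 0 + jE p) * Θ (Y * 0 + jE p)) + ρ (c * ((Y * 0 + jE p) * Θ (Y * 0 + jE p))))) := by ring
  rw [e]
  exact (Valuation.map_add _ _ _).trans (max_le hz hsmall)

/-! ## §3 The three letters from the μ-currency sizes (the lower line of the (β₂) cone ledger) -/

omit [Valued E ℤᵐ⁰] in
/-- **THE THREE LETTERS FROM SIZES.**  `c = μ∕(cc(α − ρα)·ΘY)` with `|ΘY| = |Y| = |ϖE|^b`, `cc(α − ρα) ≠ 0`; sizes `g1 : |μ|·|ϖE|^{d₁} ≤ |α − ρα|·|ϖE|^b·|ϖE|^m`,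
`g2 : |μ|·|Θα − α| ≤ |α − ρα|·|ϖE|^b·|ϖE|^m`, `g3 : |μ|·|cc| ≤ |α − ρα|·|ϖE|^b·|ϖE|^m`.  THEN `h1 h2 h3` of §1–§2 hold for `c`. [cite: Serre1979, Ch. III §6 Prop. 12] -/
theorem line_letters_of_sizes (hvΘ : ∀ x, Valued.v (Θ x) = Valued.v x) (jE : E →+* M) {ϖ : E}
    {cc Y μ : M} (hcc : cc * (α - ρ α) ≠ 0) {b : ℕ} (hYb : Valued.v Y = Valued.v (jE ϖ) ^ b) (hY0 : Y ≠ 0) {d₁ m : ℕ}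
    (g1 : Valued.v μ * Valued.v (jE ϖ) ^ d₁ ≤ Valued.v (α - ρ α) * Valued.v (jE ϖ) ^ b * Valued.v (jE ϖ) ^ m)
    (g2 : Valued.v μ * Valued.v (Θ α - α) ≤ Valued.v (α - ρ α) * Valued.v (jE ϖ) ^ b * Valued.v (jE ϖ) ^ m)
    (g3 : Valued.v μ * Valued.v cc ≤ Valued.v (α - ρ α) * Valued.v (jE ϖ) ^ b * Valued.v (jE ϖ) ^ m) :
    Valued.v (μ / (cc * (α - ρ α) * Θ Y)) * Valued.v cc * Valued.v (jE ϖ) ^ d₁ ≤ Valued.v (jE ϖ) ^ m ∧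
      Valued.v (μ / (cc * (α - ρ α) * Θ Y)) * Valued.v cc * Valued.v (Θ α - α) ≤ Valued.v (jE ϖ) ^ m ∧
      Valued.v (μ / (cc * (α - ρ α) * Θ Y)) * Valued.v cc * Valued.v cc ≤ Valued.v (jE ϖ) ^ m := by
  have hc0 : cc ≠ 0 := fun h0 => hcc (by rw [h0, zero_mul])
  have hvc0 : Valued.v cc ≠ 0 := (Valuation.ne_zero_iff _).2 hc0
  have hα0 : α - ρ α ≠ 0 := fun h0 => hcc (by rw [h0, mul_zero])
  have hvαpos : 0 < Valued.v (α - ρ α) := zero_lt_iff.2 ((Valuation.ne_zero_iff _).2 hα0)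
  have hΘY0 : Θ Y ≠ 0 := (map_ne_zero Θ).2 hY0
  have hvYpos : 0 < Valued.v Y := zero_lt_iff.2 ((Valuation.ne_zero_iff _).2 hY0)
  -- `|c|·|cc| = |μ| ∕ (|α − ρα|·|Y|)`
  have key : ∀ t : ℤᵐ⁰, Valued.v μ * t ≤ Valued.v (α - ρ α) * Valued.v (jE ϖ) ^ b * Valued.v (jE ϖ) ^ m →
      Valued.v (μ / (cc * (α - ρ α) * Θ Y)) * Valued.v cc * t ≤ Valued.v (jE ϖ) ^ m := fun t ht => by
    have e : Valued.v (μ / (cc * (α - ρ α) * Θ Y)) * Valued.v cc * t = Valued.v μ * t / (Valued.v (α - ρ α) * Valued.v Y) := by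
      rw [Valuation.map_div, Valuation.map_mul, Valuation.map_mul, hvΘ]
      field_simp
    rw [e, div_le_iff₀ (mul_pos hvαpos hvYpos), ← hYb] at *
    calc Valued.v μ * t ≤ Valued.v (α - ρ α) * Valued.v Y * Valued.v (jE ϖ) ^ m := ht
      _ = Valued.v (jE ϖ) ^ m * (Valued.v (α - ρ α) * Valued.v Y) := by ac_rfl
  exact ⟨key _ g1, key _ g2, key _ g3⟩

/-- **HEAD — «THE LETTER OF A CONE VERTEX IS A RAY, FROM SIZES» (the lower line, any band).**  ★ DEFS' `M`-letters + `Θ ∘ jE = jE ∘ σ` + `jE` isometric + the trace bound on `E`;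
CELL `cc` (`ρcc = cc`, `|cc| ≤ 1`, `cc(α − ρα) ≠ 0`), form scalar `h_M ≠ 0`, `Θh_M = h_M`, generator `x₀ ≠ 0`, `Y = dualGen ρ Θ α cc h_M x₀ ∈ 𝒪_cc` with `|Y| = |ϖE|^b`; the depth
element `μ` with the three μ-currency sizes `g1 g2 g3` at the modulus `m`; the ray scalar `jE e₀ = Tr_ρ(μ∕(cc(α − ρα)·ΘY))`.  THEN the norm-form letter of ★ p861372 HEAD B over
`Λ = x₀·𝒪_cc` IS `valueSetMod σ ϖ m ((e₀·t₊⁻¹) • xPlus σ ϖ d)` — the conclusion of ★ p861653 `normFormSet_eq_ray_of_isOrd` WITHOUT ray domination.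
[cite: Rogawski1990, §4.9 Prop. 4.9.1 (b) p. 55] [cite: Serre1979, Ch. III §3 Prop. 7; Ch. V §3 Cor. 3] [cite: Jacobowitz1962, §4] [cite: Kottwitz1986BaseChangeUnits, §1 pp. 240–241] -/
theorem normFormSet_eq_ray_of_line_sizes (hρρ : ∀ x, ρ (ρ x) = x) (hvρ : ∀ x, Valued.v (ρ x) = Valued.v x) (hα : ρ α ≠ α) (hα1 : Valued.v α ≤ 1)
    (hvΘ : ∀ x, Valued.v (Θ x) = Valued.v x)
    (σ : E →+* E) (hσσ : ∀ x, σ (σ x) = x) (hvσ : ∀ a, Valued.v (σ a) = Valued.v a)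
    {ϖ : E} (hϖ : Valued.v ϖ = exp (-1 : ℤ)) {d : ℕ} (hd : Valued.v (ϖ - σ ϖ) = Valued.v ϖ ^ d)
    (jE : E →+* M) (hjv : ∀ c, Valued.v (jE c) ≤ 1 ↔ Valued.v c ≤ 1) (hjiso : ∀ x, Valued.v (jE x) = Valued.v x)
    (hΘj : ∀ x, Θ (jE x) = jE (σ x)) (hjfix : ∀ z, ρ z = z ↔ ∃ c, jE c = z)
    {d₁ : ℕ} (htr : ∀ x : E, Valued.v (x + σ x) ≤ Valued.v ϖ ^ d₁ * Valued.v x)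
    {cc : M} (hc1 : Valued.v cc ≤ 1) (hcc : cc * (α - ρ α) ≠ 0) {hM x₀ : M}
    (hYO : IsOrd ρ α cc (dualGen ρ Θ α cc hM x₀)) {b : ℕ} (hYb : Valued.v (dualGen ρ Θ α cc hM x₀) = Valued.v (jE ϖ) ^ b)
    {μ : M} (m : ℕ)
    (g1 : Valued.v μ * Valued.v (jE ϖ) ^ d₁ ≤ Valued.v (α - ρ α) * Valued.v (jE ϖ) ^ b * Valued.v (jE ϖ) ^ m)
    (g2 : Valued.v μ * Valued.v (Θ α - α) ≤ Valued.v (α - ρ α) * Valued.v (jE ϖ) ^ b * Valued.v (jE ϖ) ^ m)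
    (g3 : Valued.v μ * Valued.v cc ≤ Valued.v (α - ρ α) * Valued.v (jE ϖ) ^ b * Valued.v (jE ϖ) ^ m)
    {e₀ : E} (he₀ : jE e₀ = μ / (cc * (α - ρ α) * Θ (dualGen ρ Θ α cc hM x₀)) + ρ (μ / (cc * (α - ρ α) * Θ (dualGen ρ Θ α cc hM x₀)))) :
    {z : E | ∃ (ζ : M) (a : E), IsOrd ρ α cc ζ ∧ Valued.v a ≤ 1 ∧
        Valued.v ((jE ϖ ^ m)⁻¹ * (jE z -
          (μ / (cc * (α - ρ α) * Θ (dualGen ρ Θ α cc hM x₀)) * ((dualGen ρ Θ α cc hM x₀ * ζ + jE a) * Θ (dualGen ρ Θ α cc hM x₀ * ζ + jE a)) +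
            ρ (μ / (cc * (α - ρ α) * Θ (dualGen ρ Θ α cc hM x₀)) * ((dualGen ρ Θ α cc hM x₀ * ζ + jE a) * Θ (dualGen ρ Θ α cc hM x₀ * ζ + jE a)))))) ≤ 1} =
      valueSetMod σ ϖ m ((e₀ * ((ϖ - σ ϖ) * ((ϖ * σ ϖ) ^ ((d - d % 2) / 2))⁻¹)⁻¹) • xPlus σ ϖ d) := by
  have hvϖ0 : Valued.v ϖ ≠ 0 := by rw [hϖ]; exact exp_ne_zero
  have hϖ0 : ϖ ≠ 0 := fun h0 => hvϖ0 (by rw [h0, map_zero])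
  have hjϖ0 : jE ϖ ≠ 0 := (map_ne_zero jE).2 hϖ0
  have hY0 : dualGen ρ Θ α cc hM x₀ ≠ 0 := fun h0 => by
    rw [h0, Valuation.map_zero] at hYb
    exact pow_ne_zero b ((Valuation.ne_zero_iff _).2 hjϖ0) hYb.symm
  obtain ⟨h1, h2, h3⟩ := line_letters_of_sizes (ρ := ρ) hvΘ jE hcc hYb hY0 g1 g2 g3
  exact normFormSet_eq_ray_of_trace hρρ hvρ hα hα1 hvΘ σ hσσ hvσ hϖ hd jE hjv hjiso hΘj hjfix htr hc1 hYO _ he₀ m h1 h2 h3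

end Summit.HodgeConjecture.HodgeConjecture.Cruxes.H413.F0P3cDyRamNormFormRayOfTrace

end
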